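import Mathlib
import HarnessLib
import Literature.Analysis.Calculus.CompIncrementChain
import Summits.HubbardSuperconductivity.HubbardSuperconductivity.Theorems.KLProgrammeKLRegimeSymbolFrameProfileFourth

/-!
# Route `KLProgramme` — crux K3 ENGINE (stmt-HubbardSuperconductivity-20437) stub (b) conj. 2 / VL (stmt-…-20440) M2 (c2): the radial-profile INCREMENT
# between two bands read along the TIME line `s ↦ k₀ + s·h₀` (the Matsubara direction) — value and first three derivatives/differences, every term
# carrying the piece `ν`

Cell `gate-hubbard-kl`, seat hubbard-kl-k3c3-p2 (g10); companion of `…FatMultiplierIncrementLine` (the SPACE line, where `e`, `ν` vary and `k₀` is fixed).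
Along the time line the bands are CONSTANT (`e`, `ν` numbers) and the Matsubara variable moves: the increment is
`I(s) = Gₙ((k₀+s h₀)² + (e−ν)²) − Gₙ((k₀+s h₀)² + e²) = (Gₙ∘(U+W) − Gₙ∘U)(s)` with `U(s) = (k₀+s h₀)² + e²` (`U₁ = 2(k₀+sh₀)h₀`, `U₂ = 2h₀²`, `U₃ = 0`) and the
CONSTANT shift `W = −ν(2e−ν)` (`W₁ = W₂ = W₃ = 0`), so `Literature.Analysis.Calculus.CompIncrementChain` applies with every `W_i = 0`, `i ≥ 1`; the localisation is
`|k₀ + s h₀| ≤ Λ` (else both arguments exceed `Λ²` and every jet of `Gₙ` vanishes) and `|e| ≤ Λ + P₀` is not even needed for the bounds (only `|ν| ≤ P₀`, `|e| ≤ E`).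

* `profileIncr_time_hasDerivAt_chain_bounds` — `∃ I₁ I₂ I₃` (`HasDerivAt` links along the time line) with
  `‖I‖ ≤ C₁W₀`, `‖I₁‖ ≤ C₂W₀D₁`, `‖I₂‖ ≤ C₃W₀D₁² + C₂W₀D₂`, `‖I₃‖ ≤ C₄W₀D₁³ + 3C₃W₀D₁D₂`,
  `C_k = d e₀^{2k}/Λ^{2k}`, `D₁ = 2Λ|h₀|`, `D₂ = 2h₀²`, `W₀ = P₀(2E + P₀)` (`|e| ≤ E`, `|ν| ≤ P₀`);
* **`norm_fwdDiff_iter_profileIncr_time_le`** — `‖Δ_δ^k I(t)‖ ≤ δ^k·(those bounds)`, `k = 0, …, 3`, `δ ≥ 0`.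

Everything is proved; no definitions, no sorry.  Nothing asserts superconductivity. [cite: BenfattoGiulianiMastropietro2006, §2.5 (2.53), §3 (3.2)–(3.8)]
-/

noncomputable section

namespace Summit.HubbardSuperconductivity.HubbardSuperconductivity.Theorems.TorusFourierL2

set_option linter.dupNamespace false -- summit = problem name (single-conjunct summit), D-0017

open Set Literature.MathematicalPhysics.QuantumLattice Literature.MathematicalPhysics.QuantumLattice.FermiRG
open Literature.Probability.LatticeModels Literature.Analysis.Calculus
open Summit.HubbardSuperconductivity.HubbardSuperconductivity.Theorems.KLRegimeSplit
open Summit.HubbardSuperconductivity.HubbardSuperconductivity.Theorems.KLProgrammeLegKernels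

section ProfileIncrTime

variable {e₀ : ℝ} (he : 0 < e₀) (n : ℕ) {d : ℝ} (hd1 : ∀ u, |deriv (bgmCutoffSq e₀) u| ≤ d)
  (hd2 : ∀ u, |iteratedDeriv 2 (bgmCutoffSq e₀) u| ≤ d) (hd3 : ∀ u, |iteratedDeriv 3 (bgmCutoffSq e₀) u| ≤ d)
  (hd4 : ∀ u, |iteratedDeriv 4 (bgmCutoffSq e₀) u| ≤ d)
  (k₀ h₀ e ν : ℝ) {E P₀ : ℝ} (hE : |e| ≤ E) (hP₀ : |ν| ≤ P₀)

include he hd1 hd2 hd3 hd4 hE hP₀ in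
/-- **The derivative chain of the profile increment along the time line, with pointwise bounds** (see the module docstring):
`I(s) = Gₙ((k₀+s h₀)² + (e−ν)²) − Gₙ((k₀+s h₀)² + e²)`. [cite: BenfattoGiulianiMastropietro2006, §3 (3.2)–(3.8)] -/
theorem profileIncr_time_hasDerivAt_chain_bounds {C₁ C₂ C₃ C₄ D₁ D₂ W₀ : ℝ}
    (hC₁ : C₁ = d * e₀ ^ 2 / klScale e₀ n ^ 2) (hC₂ : C₂ = d * e₀ ^ 4 / klScale e₀ n ^ 4) (hC₃ : C₃ = d * e₀ ^ 6 / klScale e₀ n ^ 6)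
    (hC₄ : C₄ = d * e₀ ^ 8 / klScale e₀ n ^ 8) (hD₁ : D₁ = 2 * klScale e₀ n * |h₀|) (hD₂ : D₂ = 2 * h₀ ^ 2) (hW₀ : W₀ = P₀ * (2 * E + P₀)) :
    ∃ I₁ I₂ I₃ : ℝ → ℂ,
      (∀ s, HasDerivAt (fun s => ((bgmCutoffSq e₀ ((16 : ℝ) ^ n * ((k₀ + s * h₀) ^ 2 + (e - ν) ^ 2)) : ℝ) : ℂ) -
        ((bgmCutoffSq e₀ ((16 : ℝ) ^ n * ((k₀ + s * h₀) ^ 2 + e ^ 2)) : ℝ) : ℂ)) (I₁ s) s) ∧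
      (∀ s, HasDerivAt I₁ (I₂ s) s) ∧ (∀ s, HasDerivAt I₂ (I₃ s) s) ∧
      (∀ s, ‖((bgmCutoffSq e₀ ((16 : ℝ) ^ n * ((k₀ + s * h₀) ^ 2 + (e - ν) ^ 2)) : ℝ) : ℂ) -
        ((bgmCutoffSq e₀ ((16 : ℝ) ^ n * ((k₀ + s * h₀) ^ 2 + e ^ 2)) : ℝ) : ℂ)‖ ≤ C₁ * W₀) ∧
      (∀ s, ‖I₁ s‖ ≤ C₂ * W₀ * D₁) ∧ (∀ s, ‖I₂ s‖ ≤ C₃ * W₀ * D₁ ^ 2 + C₂ * W₀ * D₂) ∧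
      (∀ s, ‖I₃ s‖ ≤ C₄ * W₀ * D₁ ^ 3 + 3 * (C₃ * W₀ * (D₁ * D₂))) := by
  have hΛ : 0 < klScale e₀ n := by rw [klScale]; positivity
  have hd0 : 0 ≤ d := (abs_nonneg _).trans (hd1 0)
  have hE0 : 0 ≤ E := (abs_nonneg _).trans hE
  have hP0 : 0 ≤ P₀ := (abs_nonneg _).trans hP₀
  have c1 : 0 ≤ C₁ := by rw [hC₁]; positivity
  have c2 : 0 ≤ C₂ := by rw [hC₂]; positivity
  have c3 : 0 ≤ C₃ := by rw [hC₃]; positivity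
  have c4 : 0 ≤ C₄ := by rw [hC₄]; positivity
  have d1 : 0 ≤ D₁ := by rw [hD₁]; positivity
  have d2 : 0 ≤ D₂ := by rw [hD₂]; positivity
  have w0 : 0 ≤ W₀ := by rw [hW₀]; positivity
  -- outer function
  set G : ℝ → ℝ := (fun u => bgmCutoffSq e₀ ((16 : ℝ) ^ n * u)) with hG
  set g₀ : ℝ → ℂ := fun u => ((G u : ℝ) : ℂ) with hg₀
  set g₁ : ℝ → ℂ := fun u => ((iteratedDeriv 1 G u : ℝ) : ℂ) with hg₁
  set g₂ : ℝ → ℂ := fun u => ((iteratedDeriv 2 G u : ℝ) : ℂ) with hg₂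
  set g₃ : ℝ → ℂ := fun u => ((iteratedDeriv 3 G u : ℝ) : ℂ) with hg₃
  obtain ⟨hlink, n0, n1, n2, n3, n4, i0, i1, i2, i3⟩ := scaleProfile_chain₄ he n hd1 hd2 hd3 hd4
  have hg : ∀ x, HasDerivAt g₀ (g₁ x) x := by
    intro x; have h := hlink 0 (by norm_num) x; simpa [hg₀, hg₁, hG] using h
  have hg₁' : ∀ x, HasDerivAt g₁ (g₂ x) x := fun x => hlink 1 (by norm_num) x
  have hg₂' : ∀ x, HasDerivAt g₂ (g₃ x) x := fun x => hlink 2 (by norm_num) x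
  have h₁ : ∀ x, ‖g₁ x‖ ≤ C₁ := by intro x; rw [hC₁]; exact n1 x
  have h₂ : ∀ x, ‖g₂ x‖ ≤ C₂ := by intro x; rw [hC₂]; exact n2 x
  have h₃ : ∀ x, ‖g₃ x‖ ≤ C₃ := by intro x; rw [hC₃]; exact n3 x
  have j₀ : ∀ x y, ‖g₀ (x + y) - g₀ x‖ ≤ C₁ * |y| := by
    intro x y; rw [hC₁]; have h := i0 x y; simpa [hg₀, hG] using h
  have j₁ : ∀ x y, ‖g₁ (x + y) - g₁ x‖ ≤ C₂ * |y| := by intro x y; rw [hC₂]; exact i1 x y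
  have j₂ : ∀ x y, ‖g₂ (x + y) - g₂ x‖ ≤ C₃ * |y| := by intro x y; rw [hC₃]; exact i2 x y
  have j₃ : ∀ x y, ‖g₃ (x + y) - g₃ x‖ ≤ C₄ * |y| := by intro x y; rw [hC₄]; exact i3 x y
  -- inner curves: `U(s) = (k₀ + s h₀)² + e²`, constant shift `W = −ν(2e−ν)`
  set U : ℝ → ℝ := fun s => (k₀ + s * h₀) ^ 2 + e ^ 2 with hU
  set U₁ : ℝ → ℝ := fun s => 2 * (k₀ + s * h₀) * h₀ with hU₁
  set U₂ : ℝ → ℝ := fun _ => 2 * h₀ ^ 2 with hU₂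
  set U₃ : ℝ → ℝ := fun _ => 0 with hU₃
  set W : ℝ → ℝ := fun _ => -(ν * (2 * e - ν)) with hW
  set Z₀ : ℝ → ℝ := fun _ => 0 with hZ₀
  have key : ∀ {f g : ℝ → ℝ} {f' g' t : ℝ}, HasDerivAt f f' t → (∀ s, g s = f s) → g' = f' → HasDerivAt g g' t := by
    intro f g f' g' t h hfg hd
    have hfg' : g = f := funext hfg
    rw [hfg', hd]; exact h
  have hlin : ∀ s, HasDerivAt (fun s => k₀ + s * h₀) h₀ s := fun s => by
    simpa using ((hasDerivAt_id s).mul_const h₀).const_add k₀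
  have hU' : ∀ s, HasDerivAt U (U₁ s) s := fun s =>
    key (((hlin s).fun_mul (hlin s)).add_const (e ^ 2)) (fun s => by simp only [hU]; ring) (by simp only [hU₁]; ring)
  have hU₁' : ∀ s, HasDerivAt U₁ (U₂ s) s := fun s =>
    key (((hlin s).const_mul 2).mul_const h₀) (fun s => by simp only [hU₁]) (by simp only [hU₂]; ring)
  have hU₂' : ∀ s, HasDerivAt U₂ (U₃ s) s := fun s => by simp only [hU₂, hU₃]; exact hasDerivAt_const s _
  have hW' : ∀ s, HasDerivAt W (Z₀ s) s := fun s => by simp only [hW, hZ₀]; exact hasDerivAt_const s _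
  have hZ₀' : ∀ s, HasDerivAt Z₀ (Z₀ s) s := fun s => by simp only [hZ₀]; exact hasDerivAt_const s _
  -- the chain
  set H : ℕ → ℝ → ℂ := fun k t =>
      if k = 0 then g₀ (U t + W t) - g₀ (U t)
      else if k = 1 then g₁ (U t + W t) * ((U₁ t + Z₀ t : ℝ) : ℂ) - g₁ (U t) * (U₁ t : ℂ)
      else if k = 2 then (g₂ (U t + W t) * ((U₁ t + Z₀ t : ℝ) : ℂ) ^ 2 + g₁ (U t + W t) * ((U₂ t + Z₀ t : ℝ) : ℂ)) -
        (g₂ (U t) * (U₁ t : ℂ) ^ 2 + g₁ (U t) * (U₂ t : ℂ))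
      else if k = 3 then (g₃ (U t + W t) * ((U₁ t + Z₀ t : ℝ) : ℂ) ^ 3 + 3 * (g₂ (U t + W t) * ((U₁ t + Z₀ t : ℝ) : ℂ) *
          ((U₂ t + Z₀ t : ℝ) : ℂ)) + g₁ (U t + W t) * ((U₃ t + Z₀ t : ℝ) : ℂ)) -
        (g₃ (U t) * (U₁ t : ℂ) ^ 3 + 3 * (g₂ (U t) * (U₁ t : ℂ) * (U₂ t : ℂ)) + g₁ (U t) * (U₃ t : ℂ))
      else 0 with hH
  have hchain : ∀ k < 3, ∀ t, HasDerivAt (H k) (H (k + 1) t) t :=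
    hasDerivAt_comp_incr_chain hg hg₁' hg₂' hU' hU₁' hU₂' hW' hZ₀' hZ₀'
  have hI : (fun s => ((bgmCutoffSq e₀ ((16 : ℝ) ^ n * ((k₀ + s * h₀) ^ 2 + (e - ν) ^ 2)) : ℝ) : ℂ) -
      ((bgmCutoffSq e₀ ((16 : ℝ) ^ n * ((k₀ + s * h₀) ^ 2 + e ^ 2)) : ℝ) : ℂ)) = H 0 := by
    funext s
    have e1 : (k₀ + s * h₀) ^ 2 + (e - ν) ^ 2 = U s + W s := by simp only [hU, hW]; ring
    simp only [hH, hg₀, hG, if_true]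
    rw [e1]
  -- localisation: if `|k₀ + s h₀| > Λ` both arguments exceed `Λ²`
  have far : ∀ s, ¬ |k₀ + s * h₀| ≤ klScale e₀ n → ∀ k, iteratedDeriv k G (U s) = 0 ∧ iteratedDeriv k G (U s + W s) = 0 := by
    intro s hs k
    rw [not_le] at hs
    have sq : klScale e₀ n ^ 2 < (k₀ + s * h₀) ^ 2 := by
      have : klScale e₀ n ^ 2 < |k₀ + s * h₀| ^ 2 := by gcongr
      rwa [sq_abs] at this
    have h1 : klScale e₀ n ^ 2 < U s := by simp only [hU]; nlinarith [sq_nonneg e]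
    have h2 : klScale e₀ n ^ 2 < U s + W s := by simp only [hU, hW]; nlinarith [sq_nonneg (e - ν)]
    exact ⟨scaleProfile_iteratedDeriv_eq_zero he n k h1, scaleProfile_iteratedDeriv_eq_zero he n k h2⟩
  -- localised bounds of the inner data
  have bnd : ∀ s, |k₀ + s * h₀| ≤ klScale e₀ n →
      |U₁ s| ≤ D₁ ∧ |U₂ s| ≤ D₂ ∧ |U₃ s| ≤ 0 ∧ |W s| ≤ W₀ ∧ |Z₀ s| ≤ 0 := by
    intro s hs
    refine ⟨?_, ?_, ?_, ?_, ?_⟩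
    · simp only [hU₁, hD₁]; rw [abs_mul, abs_mul, abs_two]
      exact mul_le_mul_of_nonneg_right (mul_le_mul_of_nonneg_left hs (by norm_num)) (abs_nonneg _)
    · simp only [hU₂, hD₂]; rw [abs_of_nonneg (by positivity)]
    · simp [hU₃, hZ₀]
    · simp only [hW, hW₀]; rw [abs_neg, abs_mul]
      refine mul_le_mul hP₀ ((abs_sub _ _).trans ?_) (abs_nonneg _) hP0
      rw [abs_mul, abs_two]; linarith
    · simp [hZ₀]
  have B0 : ∀ s, ‖H 0 s‖ ≤ C₁ * W₀ := by
    intro s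
    have h0 : H 0 s = g₀ (U s + W s) - g₀ (U s) := by simp [hH]
    rw [h0]
    by_cases hs : |k₀ + s * h₀| ≤ klScale e₀ n
    · obtain ⟨-, -, -, bW, -⟩ := bnd s hs
      exact norm_comp_incr_le j₀ bW
    · have z1 := (far s hs 0).1; have z2 := (far s hs 0).2
      rw [iteratedDeriv_zero] at z1 z2
      have : g₀ (U s + W s) - g₀ (U s) = 0 := by simp only [hg₀, z1, z2]; simp
      rw [this, norm_zero]; positivity
  have B1 : ∀ s, ‖H 1 s‖ ≤ C₂ * W₀ * D₁ := by
    intro s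
    have h1 : H 1 s = g₁ (U s + W s) * ((U₁ s + Z₀ s : ℝ) : ℂ) - g₁ (U s) * (U₁ s : ℂ) := by simp [hH]
    rw [h1]
    by_cases hs : |k₀ + s * h₀| ≤ klScale e₀ n
    · obtain ⟨bU₁, -, -, bW, bZ⟩ := bnd s hs
      have h := norm_comp_incr_deriv1_le (x := U s) h₁ j₁ bU₁ bW bZ
      have e0 : C₂ * W₀ * (D₁ + 0) + C₁ * 0 = C₂ * W₀ * D₁ := by ring
      rw [e0] at h; exact h
    · have z1 := (far s hs 1).1; have z2 := (far s hs 1).2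
      have : g₁ (U s + W s) * ((U₁ s + Z₀ s : ℝ) : ℂ) - g₁ (U s) * (U₁ s : ℂ) = 0 := by simp only [hg₁, z1, z2]; simp
      rw [this, norm_zero]; positivity
  have B2 : ∀ s, ‖H 2 s‖ ≤ C₃ * W₀ * D₁ ^ 2 + C₂ * W₀ * D₂ := by
    intro s
    have h2 : H 2 s = (g₂ (U s + W s) * ((U₁ s + Z₀ s : ℝ) : ℂ) ^ 2 + g₁ (U s + W s) * ((U₂ s + Z₀ s : ℝ) : ℂ)) -
        (g₂ (U s) * (U₁ s : ℂ) ^ 2 + g₁ (U s) * (U₂ s : ℂ)) := by simp [hH]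
    rw [h2]
    by_cases hs : |k₀ + s * h₀| ≤ klScale e₀ n
    · obtain ⟨bU₁, bU₂, -, bW, bZ⟩ := bnd s hs
      have h := norm_comp_incr_deriv2_le (x := U s) h₁ h₂ j₁ j₂ bU₁ bU₂ bW bZ bZ
      have e0 : C₃ * W₀ * (D₁ + 0) ^ 2 + C₂ * (0 * (2 * D₁ + 0)) + (C₂ * W₀ * (D₂ + 0) + C₁ * 0) = C₃ * W₀ * D₁ ^ 2 + C₂ * W₀ * D₂ := by ring
      rw [e0] at h; exact h
    · have z1 := (far s hs 1).1; have z2 := (far s hs 1).2; have z3 := (far s hs 2).1; have z4 := (far s hs 2).2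
      have : (g₂ (U s + W s) * ((U₁ s + Z₀ s : ℝ) : ℂ) ^ 2 + g₁ (U s + W s) * ((U₂ s + Z₀ s : ℝ) : ℂ)) -
          (g₂ (U s) * (U₁ s : ℂ) ^ 2 + g₁ (U s) * (U₂ s : ℂ)) = 0 := by simp only [hg₁, hg₂, z1, z2, z3, z4]; simp
      rw [this, norm_zero]; positivity
  have B3 : ∀ s, ‖H 3 s‖ ≤ C₄ * W₀ * D₁ ^ 3 + 3 * (C₃ * W₀ * (D₁ * D₂)) := by
    intro s
    have h3 : H 3 s = (g₃ (U s + W s) * ((U₁ s + Z₀ s : ℝ) : ℂ) ^ 3 + 3 * (g₂ (U s + W s) * ((U₁ s + Z₀ s : ℝ) : ℂ) *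
          ((U₂ s + Z₀ s : ℝ) : ℂ)) + g₁ (U s + W s) * ((U₃ s + Z₀ s : ℝ) : ℂ)) -
        (g₃ (U s) * (U₁ s : ℂ) ^ 3 + 3 * (g₂ (U s) * (U₁ s : ℂ) * (U₂ s : ℂ)) + g₁ (U s) * (U₃ s : ℂ)) := by simp [hH]
    rw [h3]
    by_cases hs : |k₀ + s * h₀| ≤ klScale e₀ n
    · obtain ⟨bU₁, bU₂, bU₃, bW, bZ⟩ := bnd s hs
      have h := norm_comp_incr_deriv3_le (x := U s) h₁ h₂ h₃ j₁ j₂ j₃ bU₁ bU₂ bU₃ bW bZ bZ bZ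
      have e0 : C₄ * W₀ * (D₁ + 0) ^ 3 + C₃ * (0 * (3 * D₁ ^ 2 + 3 * D₁ * 0 + 0 ^ 2)) +
          3 * (C₃ * W₀ * ((D₁ + 0) * (D₂ + 0)) + C₂ * (D₁ * 0 + 0 * D₂ + 0 * 0)) + (C₂ * W₀ * (0 + 0) + C₁ * 0) =
          C₄ * W₀ * D₁ ^ 3 + 3 * (C₃ * W₀ * (D₁ * D₂)) := by ring
      rw [e0] at h; exact h
    · have z1 := (far s hs 1).1; have z2 := (far s hs 1).2; have z3 := (far s hs 2).1; have z4 := (far s hs 2).2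
      have z5 := (far s hs 3).1; have z6 := (far s hs 3).2
      have : (g₃ (U s + W s) * ((U₁ s + Z₀ s : ℝ) : ℂ) ^ 3 + 3 * (g₂ (U s + W s) * ((U₁ s + Z₀ s : ℝ) : ℂ) *
          ((U₂ s + Z₀ s : ℝ) : ℂ)) + g₁ (U s + W s) * ((U₃ s + Z₀ s : ℝ) : ℂ)) -
          (g₃ (U s) * (U₁ s : ℂ) ^ 3 + 3 * (g₂ (U s) * (U₁ s : ℂ) * (U₂ s : ℂ)) + g₁ (U s) * (U₃ s : ℂ)) = 0 := by
        simp only [hg₁, hg₂, hg₃, z1, z2, z3, z4, z5, z6]; simp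
      rw [this, norm_zero]; positivity
  refine ⟨H 1, H 2, H 3, fun s => ?_, hchain 1 (by norm_num), hchain 2 (by norm_num), fun s => ?_, B1, B2, B3⟩
  · have h := hchain 0 (by norm_num) s
    rw [← hI] at h; exact h
  · have h := B0 s
    have e0 : H 0 s = ((bgmCutoffSq e₀ ((16 : ℝ) ^ n * ((k₀ + s * h₀) ^ 2 + (e - ν) ^ 2)) : ℝ) : ℂ) -
        ((bgmCutoffSq e₀ ((16 : ℝ) ^ n * ((k₀ + s * h₀) ^ 2 + e ^ 2)) : ℝ) : ℂ) := by rw [← hI]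
    rw [e0] at h; exact h

include he hd1 hd2 hd3 hd4 hE hP₀ in
/-- **The differences of the profile increment along the time line, orders `0 … 3`** (`δ ≥ 0`; constants as in
`profileIncr_time_hasDerivAt_chain_bounds`). [cite: BenfattoGiulianiMastropietro2006, §3 (3.2)–(3.8)] -/
theorem norm_fwdDiff_iter_profileIncr_time_le {C₁ C₂ C₃ C₄ D₁ D₂ W₀ : ℝ}
    (hC₁ : C₁ = d * e₀ ^ 2 / klScale e₀ n ^ 2) (hC₂ : C₂ = d * e₀ ^ 4 / klScale e₀ n ^ 4) (hC₃ : C₃ = d * e₀ ^ 6 / klScale e₀ n ^ 6)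
    (hC₄ : C₄ = d * e₀ ^ 8 / klScale e₀ n ^ 8) (hD₁ : D₁ = 2 * klScale e₀ n * |h₀|) (hD₂ : D₂ = 2 * h₀ ^ 2) (hW₀ : W₀ = P₀ * (2 * E + P₀))
    {δ : ℝ} (hδ : 0 ≤ δ) (t : ℝ) :
    ‖fwdDiff δ (fun s => ((bgmCutoffSq e₀ ((16 : ℝ) ^ n * ((k₀ + s * h₀) ^ 2 + (e - ν) ^ 2)) : ℝ) : ℂ) -
        ((bgmCutoffSq e₀ ((16 : ℝ) ^ n * ((k₀ + s * h₀) ^ 2 + e ^ 2)) : ℝ) : ℂ)) t‖ ≤ δ * (C₂ * W₀ * D₁) ∧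
    ‖(fwdDiff δ)^[2] (fun s => ((bgmCutoffSq e₀ ((16 : ℝ) ^ n * ((k₀ + s * h₀) ^ 2 + (e - ν) ^ 2)) : ℝ) : ℂ) -
        ((bgmCutoffSq e₀ ((16 : ℝ) ^ n * ((k₀ + s * h₀) ^ 2 + e ^ 2)) : ℝ) : ℂ)) t‖ ≤ δ ^ 2 * (C₃ * W₀ * D₁ ^ 2 + C₂ * W₀ * D₂) ∧
    ‖(fwdDiff δ)^[3] (fun s => ((bgmCutoffSq e₀ ((16 : ℝ) ^ n * ((k₀ + s * h₀) ^ 2 + (e - ν) ^ 2)) : ℝ) : ℂ) -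
        ((bgmCutoffSq e₀ ((16 : ℝ) ^ n * ((k₀ + s * h₀) ^ 2 + e ^ 2)) : ℝ) : ℂ)) t‖ ≤ δ ^ 3 * (C₄ * W₀ * D₁ ^ 3 + 3 * (C₃ * W₀ * (D₁ * D₂))) := by
  obtain ⟨I₁, I₂, I₃, h0, h1, h2, -, b1, b2, b3⟩ :=
    profileIncr_time_hasDerivAt_chain_bounds he n hd1 hd2 hd3 hd4 k₀ h₀ e ν hE hP₀ hC₁ hC₂ hC₃ hC₄ hD₁ hD₂ hW₀
  set I : ℝ → ℂ := fun s => ((bgmCutoffSq e₀ ((16 : ℝ) ^ n * ((k₀ + s * h₀) ^ 2 + (e - ν) ^ 2)) : ℝ) : ℂ) -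
        ((bgmCutoffSq e₀ ((16 : ℝ) ^ n * ((k₀ + s * h₀) ^ 2 + e ^ 2)) : ℝ) : ℂ) with hIdef
  set H : ℕ → ℝ → ℂ := fun k => if k = 0 then I else if k = 1 then I₁ else if k = 2 then I₂ else if k = 3 then I₃ else 0 with hH
  have hchain : ∀ k < 3, ∀ s, HasDerivAt (H k) (H (k + 1) s) s := by
    intro k hk s
    interval_cases k
    · simpa [hH] using h0 s
    · simpa [hH] using h1 s
    · simpa [hH] using h2 s
  have hH0 : H 0 = I := by simp [hH]
  refine ⟨?_, ?_, ?_⟩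
  · have h := Literature.Analysis.norm_fwdDiff_iter_le_of_hasDerivAt hδ 1 H t (C₂ * W₀ * D₁)
      (fun k hk s _ => hchain k (by omega) s) (fun s _ => by simpa [hH] using b1 s)
    rw [hH0, Function.iterate_one, pow_one] at h; exact h
  · have h := Literature.Analysis.norm_fwdDiff_iter_le_of_hasDerivAt hδ 2 H t (C₃ * W₀ * D₁ ^ 2 + C₂ * W₀ * D₂)
      (fun k hk s _ => hchain k (by omega) s) (fun s _ => by simpa [hH] using b2 s)
    rw [hH0] at h; exact h
  · have h := Literature.Analysis.norm_fwdDiff_iter_le_of_hasDerivAt hδ 3 H t (C₄ * W₀ * D₁ ^ 3 + 3 * (C₃ * W₀ * (D₁ * D₂)))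
      (fun k hk s _ => hchain k hk s) (fun s _ => by simpa [hH] using b3 s)
    rw [hH0] at h; exact h

end ProfileIncrTime

end Summit.HubbardSuperconductivity.HubbardSuperconductivity.Theorems.TorusFourierL2

end
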